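import Literature.Analysis.FunctionSpaces.LittlewoodPaleyKernel
import Literature.Analysis.FunctionSpaces.LittlewoodPaleyInhomogeneousProofs
import Mathlib.Analysis.Calculus.TaylorIntegral
import Mathlib.Analysis.Fourier.FourierTransformDeriv
import HarnessLib

/-!
# `C^{k,r}_b ⊂ B^{k+r}_{∞,∞}`: the direct half of the Hölder–Zygmund characterisation

Sibling proof file of `Literature/Analysis/FunctionSpaces/LittlewoodPaley.lean` on the discharge
path of the named fact `Literature.Analysis.FunctionSpaces.memBesov_top_top_iff_memContDiffHolder`
(Triebel 1983, Thm. 2.5.7: `B^{k+r}_{∞,∞} = C^{k,r}_b` for `k ∈ ℕ`, `0 < r < 1`). Everything here is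
**proved**; this file gives the inclusion `C^{k,r}_b ⊂ B^{k+r}_{∞,∞}`:

* `Literature.Analysis.FunctionSpaces.integral_blockKernel_smul_multilinear_eq_zero` — **all
  moments of the Littlewood–Paley kernels vanish**: `∫ K_j(y) • M(y, …, y) dy = 0` for every
  continuous multilinear `M` and every `j ∈ ℤ` (`𝓕 K_j = φ_j` vanishes near the origin, so all
  derivatives of `φ_j` at `0` — the moments of `K_j`, Mathlib's `iteratedFDeriv_fourier` — are
  zero; Grafakos, *Modern Fourier Analysis*, 3rd ed., proof of Thm. 1.4.6, "`Δ_j^Ψ` is given by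
  convolution with a function with mean value zero", here at every order);
* `Literature.Analysis.FunctionSpaces.norm_sub_taylor_le_of_holderWith` — **Taylor's formula with
  Hölder remainder**: if `f ∈ C^k` and `D^k f` is `r`-Hölder with constant `C`, then
  `‖f(x + y) - ∑_{m ≤ k} D^m f(x)(y,…,y)/m!‖ ≤ C ‖y‖^k ‖y‖^r` (Mathlib's Taylor formula with
  integral remainder `map_add_eq_sum_add_integral_iteratedFDeriv` at order `k - 1`, and
  `‖D^k f(x + ty) - D^k f(x)‖ ≤ C (t‖y‖)^r` inside the integral);
* `Literature.Analysis.FunctionSpaces.norm_blockFn_le_two_rpow_neg` — the pointwise block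
  estimate `‖(Δ̇_j f)(x)‖ ≤ C [D^k f]_r 2^{-j(k+r)} ∫ |K₀(z)| ‖z‖^{k+r} dz` for `f ∈ C^{k,r}_b`
  (`Δ̇_j f = K_j ⋆ f`, the Taylor polynomial of `f` at `x` is annihilated by `K_j`, the remainder is
  `O(‖y‖^{k+r})`, and `K_j = 2^{jd} K₀(2^j ·)`);
* `Literature.Analysis.FunctionSpaces.memBesov_top_top_coe_of_memContDiffHolder` — **`C^{k,r}_b ⊂
  B^{k+r}_{∞,∞}`**: for `f ∈ C^{k,r}_b ∩ L^∞` the distribution `↑f` has finite inhomogeneous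
  `B^{k+r}_{∞,∞}` norm (`Ṡ₀ f ∈ L^∞` by Young's inequality,
  `Literature.Analysis.FunctionSpaces.eLpNormDistrib_lowFreqCutoff_coe_lt_top`, and
  `sup_{j ≥ 1} 2^{j(k+r)} ‖Δ̇_j f‖_{L^∞} < ∞` by the block estimate).

## References

* H. Triebel, *Theory of Function Spaces*, Birkhäuser (1983), §2.5.7, Theorem (ii) eq. (6)
  (`𝒞^s = B^s_{∞,∞}`, `s > 0`) and eq. (9) (`C^s = 𝒞^s` for `0 < s ∉ ℕ`), with the Hölder spaces
  `C^s` of (2.2.2/3) (held; PDF pp. 218–220 and p. 151). [cite: Triebel1983, Thm. 2.5.7]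
* L. Grafakos, *Modern Fourier Analysis*, 3rd ed., GTM 250, Springer (2014), Thm. 1.4.9, estimate
  (1.4.23) and the proof of Thm. 1.4.6 (Littlewood–Paley characterisation of the inhomogeneous
  Lipschitz spaces; held as `book:grafakos2009-modern-fourier-analysis`, PDF pp. 92–100).
* H. Bahouri, J.-Y. Chemin, R. Danchin, *Fourier Analysis and Nonlinear Partial Differential
  Equations*, Springer (2011), §2.2 (the blocks `Δ̇_j = 2^{jd} h(2^j ·) ⋆`).
-/

noncomputable section

open MeasureTheory FourierTransform SchwartzMap Real Filter Topology Function TemperedDistribution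
open scoped SchwartzMap ENNReal NNReal FourierTransform RealInnerProductSpace Convolution Nat

namespace Literature.Analysis.FunctionSpaces

/-! ## Moments of the Littlewood–Paley kernels -/

section Moments

variable {E : Type*} [NormedAddCommGroup E] [InnerProductSpace ℝ E] [FiniteDimensional ℝ E]
  [MeasurableSpace E] [BorelSpace E]

/-- **Monomial moments of a Schwartz function whose Fourier transform vanishes near the origin
are zero**: if `𝓕 K = 0` on a neighbourhood of `0`, then `∫ (∏ᵢ ⟪v, mᵢ⟫) K(v) dv = 0` for all
vectors `m₁, …, mₙ` — the `n`-th derivative of `𝓕 K` at `0` is, up to the factor `(-2πi)ⁿ`, the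
multilinear form of `n`-th moments of `K` (Mathlib's `Real.iteratedFDeriv_fourier`), and it vanishes.
(Grafakos, *Classical Fourier Analysis*, Prop. 2.2.11 (10): `∂^α f̂ = ((-2πi x)^α f)^`.) [folklore] -/
theorem integral_prod_inner_smul_eq_zero_of_fourier_eventuallyEq_zero (K : 𝓢(E, ℂ))
    (hK : ((𝓕 K : 𝓢(E, ℂ)) : E → ℂ) =ᶠ[𝓝 0] 0) (n : ℕ) (m : Fin n → E) :
    ∫ v, (∏ i, ⟪v, m i⟫) • (K v) = 0 := by
  -- the `n`-th derivative of `𝓕 K` at `0` vanishes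
  have hD0 : iteratedFDeriv ℝ n (((𝓕 K : 𝓢(E, ℂ)) : E → ℂ)) 0 = 0 := by
    have h := (hK.iteratedFDeriv ℝ n).eq_of_nhds
    rw [h]
    simp
  -- and it is the Fourier integral of the moment forms, evaluated at `0`
  have hint : ∀ l : ℕ, (l : ℕ∞) ≤ (n : ℕ∞) →
      Integrable (fun v : E => ‖v‖ ^ l * ‖(K : E → ℂ) v‖) volume := fun l _ =>
    K.integrable_pow_mul volume l
  have hderiv := Real.iteratedFDeriv_fourier (f := (K : E → ℂ)) (N := (n : ℕ∞)) hint
    K.continuous.aestronglyMeasurable (n := n) le_rfl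
  rw [SchwartzMap.fourier_coe] at hD0
  rw [hderiv, Real.fourier_eq] at hD0
  simp only [inner_zero_right, neg_zero, AddChar.map_zero_eq_one, one_smul] at hD0
  -- evaluate the vanishing multilinear-valued integral at `m`
  have hI : Integrable (fun v : E => VectorFourier.fourierPowSMulRight (innerSL ℝ) (K : E → ℂ) v n)
      volume :=
    VectorFourier.integrable_fourierPowSMulRight (innerSL ℝ) (K.integrable_pow_mul volume n)
      K.continuous.aestronglyMeasurable
  have happly := ContinuousMultilinearMap.integral_apply hI m
  rw [hD0, zero_apply] at happly
  simp only [VectorFourier.fourierPowSMulRight_apply] at happly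
  rw [integral_smul, eq_comm, smul_eq_zero] at happly
  rcases happly with h | h
  · exact absurd h (pow_ne_zero _ (neg_ne_zero.2 (mul_ne_zero (mul_ne_zero two_ne_zero
      (Complex.ofReal_ne_zero.2 Real.pi_ne_zero)) Complex.I_ne_zero)))
  · exact h

/-- The Fourier transform of the Littlewood–Paley kernel `h_j = 𝓕⁻¹φ_j` is the dyadic symbol
`φ_j`, which vanishes on the ball `‖ξ‖ ≤ 2^{j-1}`, a neighbourhood of the origin. [folklore] -/
theorem fourier_blockKernelC_eventuallyEq_zero (j : ℤ) :
    ((𝓕 (blockKernelC E j) : 𝓢(E, ℂ)) : E → ℂ) =ᶠ[𝓝 0] 0 := by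
  rw [blockKernelC, FourierTransform.fourier_fourierInv_eq, coe_dyadicSymbolSchwartz]
  have hball : Metric.closedBall (0 : E) ((2 : ℝ) ^ (j - 1)) ∈ 𝓝 (0 : E) :=
    Metric.closedBall_mem_nhds 0 (zpow_pos two_pos _)
  filter_upwards [hball] with ξ hξ
  rw [Metric.mem_closedBall, dist_zero_right] at hξ
  exact dyadicSymbol_apply_of_norm_le_holds hξ

/-- **Monomial moments of the Littlewood–Paley kernels vanish**:
`∫ (∏ᵢ ⟪v, mᵢ⟫) h_j(v) dv = 0` for the complex kernel `h_j = 𝓕⁻¹φ_j` and all `m₁, …, mₙ`, `n ∈ ℕ`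
(including `n = 0`: `∫ h_j = φ_j(0) = 0`). [folklore] -/
theorem integral_prod_inner_smul_blockKernelC_eq_zero (j : ℤ) (n : ℕ) (m : Fin n → E) :
    ∫ v, (∏ i, ⟪v, m i⟫) • (blockKernelC E j v) = 0 :=
  integral_prod_inner_smul_eq_zero_of_fourier_eventuallyEq_zero _
    (fourier_blockKernelC_eventuallyEq_zero j) n m

/-- The same for the real kernel `K_j = Re h_j`: `∫ K_j(v) ∏ᵢ ⟪v, mᵢ⟫ dv = 0`. [folklore] -/
theorem integral_blockKernel_mul_prod_inner_eq_zero (j : ℤ) (n : ℕ) (m : Fin n → E) :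
    ∫ v, blockKernel E j v * ∏ i, ⟪v, m i⟫ = 0 := by
  have h := integral_prod_inner_smul_blockKernelC_eq_zero (E := E) j n m
  have hfun : (fun v : E => (∏ i, ⟪v, m i⟫) • blockKernelC E j v) =
      fun v : E => ((blockKernel E j v * ∏ i, ⟪v, m i⟫ : ℝ) : ℂ) := by
    funext v
    rw [← ofReal_blockKernel, Complex.real_smul, Complex.ofReal_mul, mul_comm]
  rw [hfun, integral_complex_ofReal, Complex.ofReal_eq_zero] at h
  exact h

variable {F : Type*} [NormedAddCommGroup F] [NormedSpace ℝ F]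

/-- The moment integrands `v ↦ K_j(v) • M(v, …, v)` are integrable (`‖M(v,…,v)‖ ≤ ‖M‖ ‖v‖ⁿ` and
`K_j` is a Schwartz function). [folklore] -/
theorem integrable_blockKernel_smul_multilinear (j : ℤ) {n : ℕ} (M : E [×n]→L[ℝ] F) :
    Integrable (fun v : E => blockKernel E j v • M (fun _ => v)) volume := by
  have hM : Continuous fun v : E => M (fun _ => v) :=
    M.cont.comp (continuous_pi fun _ => continuous_id)
  refine Integrable.mono' (g := fun v : E => ‖M‖ * (‖v‖ ^ n * ‖(blockKernelC E j : E → ℂ) v‖))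
    (((blockKernelC E j).integrable_pow_mul volume n).const_mul ‖M‖)
    ((continuous_blockKernel j).aestronglyMeasurable.smul hM.aestronglyMeasurable)
    (Eventually.of_forall fun v => ?_)
  rw [norm_smul, norm_blockKernel]
  calc ‖blockKernelC E j v‖ * ‖M fun _ => v‖ ≤ ‖blockKernelC E j v‖ * (‖M‖ * ∏ _i : Fin n, ‖v‖) :=
        mul_le_mul_of_nonneg_left (M.le_opNorm _) (norm_nonneg _)
    _ = ‖M‖ * (‖v‖ ^ n * ‖(blockKernelC E j : E → ℂ) v‖) := by
        rw [Finset.prod_const, Finset.card_univ, Fintype.card_fin]; ring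

/-- **All moments of the Littlewood–Paley kernels vanish**: for every continuous `n`-multilinear
map `M : Eⁿ → F` and every `j ∈ ℤ`, `∫ K_j(v) • M(v, …, v) dv = 0` (expand `v` in an orthonormal
basis: `M(v,…,v)` is a combination of the monomials `∏ₗ ⟪v, b_{iₗ}⟫`, whose `K_j`-moments vanish,
`integral_blockKernel_mul_prod_inner_eq_zero`). In particular the blocks `Δ̇_j` annihilate
polynomials (Grafakos, *Modern Fourier Analysis*, 3rd ed., §1.4.1 and the proof of Thm. 1.4.6). [folklore] -/
theorem integral_blockKernel_smul_multilinear_eq_zero [CompleteSpace F] (j : ℤ) {n : ℕ}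
    (M : E [×n]→L[ℝ] F) :
    ∫ v, blockKernel E j v • M (fun _ => v) = 0 := by
  classical
  set b : OrthonormalBasis (Fin (Module.finrank ℝ E)) ℝ E := stdOrthonormalBasis ℝ E with hb
  -- expand `M(v, …, v)` along the basis
  have hexp : ∀ v : E, M (fun _ => v) =
      ∑ σ : Fin n → Fin (Module.finrank ℝ E), (∏ l, ⟪v, b (σ l)⟫) • M (fun l => b (σ l)) := by
    intro v
    conv_lhs => rw [show (fun _ : Fin n => v) = fun _ : Fin n => ∑ i, ⟪b i, v⟫ • b i from
      funext fun _ => (b.sum_repr' v).symm]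
    rw [ContinuousMultilinearMap.map_sum]
    refine Finset.sum_congr rfl fun σ _ => ?_
    rw [ContinuousMultilinearMap.map_smul_univ]
    congr 1
    exact Finset.prod_congr rfl fun l _ => real_inner_comm _ _
  have hint : ∀ σ : Fin n → Fin (Module.finrank ℝ E),
      Integrable (fun v : E => blockKernel E j v • ((∏ l, ⟪v, b (σ l)⟫) • M (fun l => b (σ l))))
        volume := by
    intro σ
    have h := integrable_blockKernel_smul_multilinear (F := F) j
      (M.compContinuousLinearMap fun l => (innerSL ℝ (b (σ l))).smulRight (b (σ l)))
    refine h.congr (Eventually.of_forall fun v => ?_)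
    simp only [ContinuousMultilinearMap.compContinuousLinearMap_apply,
      ContinuousLinearMap.smulRight_apply, innerSL_apply_apply]
    rw [ContinuousMultilinearMap.map_smul_univ]
    congr 2
    exact Finset.prod_congr rfl fun l _ => real_inner_comm _ _
  simp_rw [hexp, Finset.smul_sum]
  rw [integral_finsetSum _ fun σ _ => hint σ]
  refine Finset.sum_eq_zero fun σ _ => ?_
  simp_rw [smul_smul]
  rw [integral_smul_const, integral_blockKernel_mul_prod_inner_eq_zero, zero_smul]

end Moments

/-! ## Taylor's formula with a Hölder remainder -/

section Taylor

variable {E' : Type*} [NormedAddCommGroup E'] [NormedSpace ℝ E']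
  {F : Type*} [NormedAddCommGroup F] [NormedSpace ℝ F] [CompleteSpace F]

/-- `∫₀¹ (1 - t)ⁿ dt = 1 / (n + 1)`. [folklore] -/
theorem integral_one_sub_pow (n : ℕ) : ∫ t in (0 : ℝ)..1, (1 - t) ^ n = 1 / (n + 1) := by
  have h := intervalIntegral.integral_comp_sub_left (fun s : ℝ => s ^ n) (a := 0) (b := 1) 1
  simp only [sub_self, sub_zero] at h
  rw [h, integral_pow]
  simp

/-- **Taylor's formula with Hölder remainder.** Let `f : E' → F` be `C^k` with `r`-Hölder
continuous `k`-th derivative, `[D^k f]_r ≤ C`. Then for all `x, y`,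
`‖f(x + y) - ∑_{m=0}^{k} D^m f(x)(y, …, y) / m!‖ ≤ C ‖y‖^k ‖y‖^r`: Taylor's formula of order `k - 1`
with integral remainder (Mathlib's `map_add_eq_sum_add_integral_iteratedFDeriv`), whose remainder
`((k-1)!)⁻¹ ∫₀¹ (1-t)^{k-1} D^k f(x + ty)(y,…,y) dt` differs from the `k`-th Taylor term by
`((k-1)!)⁻¹ ∫₀¹ (1-t)^{k-1} [D^k f(x + ty) - D^k f(x)](y,…,y) dt`, and
`‖D^k f(x + ty) - D^k f(x)‖ ≤ C (t‖y‖)^r` (for `k = 0` this is the Hölder condition itself).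
(Grafakos, *Modern Fourier Analysis*, 3rd ed., (1.4.20): Taylor's theorem in the proof of
Thm. 1.4.6.) [folklore] -/
theorem norm_sub_taylor_le_of_holderWith {f : E' → F} {k : ℕ} {r C : ℝ≥0} (hf : ContDiff ℝ k f)
    (hH : HolderWith C r (iteratedFDeriv ℝ k f)) (x y : E') :
    ‖f (x + y) - ∑ m ∈ Finset.range (k + 1), (m ! : ℝ)⁻¹ • iteratedFDeriv ℝ m f x (fun _ => y)‖ ≤
      C * ‖y‖ ^ k * ‖y‖ ^ (r : ℝ) := by
  cases k with
  | zero =>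
    rw [holderWith_iteratedFDeriv_zero_iff] at hH
    have h := hH.dist_le (x + y) x
    rw [dist_eq_norm, dist_eq_norm, add_sub_cancel_left] at h
    simpa [iteratedFDeriv_zero_apply] using h
  | succ n =>
    -- Taylor's formula of order `n` with integral remainder
    have hT := map_add_eq_sum_add_integral_iteratedFDeriv (f := f) (x := x) (y := y) (n := n)
      (fun t _ => by
        have : ContDiff ℝ ((n : WithTop ℕ∞) + 1) f := by exact_mod_cast hf
        exact this.contDiffAt)
    set D : E' → E' [×(n + 1)]→L[ℝ] F := iteratedFDeriv ℝ (n + 1) f with hD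
    -- the `(n+1)`-st Taylor term as an integral over `[0, 1]`
    have hlast : (((n + 1)! : ℕ) : ℝ)⁻¹ • D x (fun _ => y) =
        (n ! : ℝ)⁻¹ • ∫ t in (0 : ℝ)..1, (1 - t) ^ n • D x (fun _ => y) := by
      rw [intervalIntegral.integral_smul_const, integral_one_sub_pow, smul_smul]
      congr 1
      rw [Nat.factorial_succ, Nat.cast_mul, Nat.cast_add_one]
      field_simp
    have hcontD : Continuous D := hf.continuous_iteratedFDeriv le_rfl
    have hc1 : Continuous fun t : ℝ => D (x + t • y) (fun _ => y) :=
      (continuous_eval_const (fun _ : Fin (n + 1) => y)).comp (hcontD.comp (by fun_prop))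
    have hi1 : IntervalIntegrable (fun t : ℝ => (1 - t) ^ n • D (x + t • y) (fun _ => y)) volume 0 1 :=
      ((by fun_prop : Continuous fun t : ℝ => (1 - t) ^ n).smul hc1).intervalIntegrable 0 1
    have hi2 : IntervalIntegrable (fun t : ℝ => (1 - t) ^ n • D x (fun _ => y)) volume 0 1 :=
      (by fun_prop : Continuous fun t : ℝ => (1 - t) ^ n • D x (fun _ => y)).intervalIntegrable 0 1
    -- the difference
    have hdiff : f (x + y) - ∑ m ∈ Finset.range (n + 1 + 1), (m ! : ℝ)⁻¹ • iteratedFDeriv ℝ m f x (fun _ => y) =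
        (n ! : ℝ)⁻¹ • ∫ t in (0 : ℝ)..1, (1 - t) ^ n • (D (x + t • y) - D x) (fun _ => y) := by
      rw [Finset.sum_range_succ, ← hD, hlast, hT]
      simp only [sub_apply, smul_sub]
      rw [intervalIntegral.integral_sub hi1 hi2, smul_sub]
      abel
    rw [hdiff, norm_smul, norm_inv, Real.norm_natCast]
    -- bound the integrand
    have hbound : ∀ t ∈ Set.uIoc (0 : ℝ) 1,
        ‖(1 - t) ^ n • (D (x + t • y) - D x) (fun _ => y)‖ ≤ C * ‖y‖ ^ (n + 1) * ‖y‖ ^ (r : ℝ) := by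
      intro t ht
      rw [Set.uIoc_of_le zero_le_one, Set.mem_Ioc] at ht
      have ht0 : 0 ≤ t := ht.1.le
      have h1t : |1 - t| ≤ 1 := by rw [abs_of_nonneg (sub_nonneg.2 ht.2)]; linarith
      have hHt : ‖D (x + t • y) - D x‖ ≤ C * ‖y‖ ^ (r : ℝ) := by
        have h := hH.dist_le (x + t • y) x
        rw [dist_eq_norm, dist_eq_norm, add_sub_cancel_left, norm_smul, Real.norm_of_nonneg ht0]
          at h
        refine h.trans ?_
        rw [Real.mul_rpow ht0 (norm_nonneg _)]
        calc (C : ℝ) * (t ^ (r : ℝ) * ‖y‖ ^ (r : ℝ)) ≤ C * (1 * ‖y‖ ^ (r : ℝ)) := by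
              gcongr
              exact Real.rpow_le_one ht0 ht.2 r.coe_nonneg
          _ = C * ‖y‖ ^ (r : ℝ) := by rw [one_mul]
      calc ‖(1 - t) ^ n • (D (x + t • y) - D x) (fun _ => y)‖
          = |1 - t| ^ n * ‖(D (x + t • y) - D x) (fun _ => y)‖ := by
            rw [norm_smul, norm_pow, Real.norm_eq_abs]
        _ ≤ 1 ^ n * (‖D (x + t • y) - D x‖ * ∏ _i : Fin (n + 1), ‖y‖) :=
            mul_le_mul (pow_le_pow_left₀ (abs_nonneg _) h1t n)
              (ContinuousMultilinearMap.le_opNorm _ _) (norm_nonneg _) (by positivity)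
        _ ≤ 1 ^ n * ((C * ‖y‖ ^ (r : ℝ)) * ∏ _i : Fin (n + 1), ‖y‖) := by gcongr
        _ = C * ‖y‖ ^ (n + 1) * ‖y‖ ^ (r : ℝ) := by
            rw [Finset.prod_const, Finset.card_univ, Fintype.card_fin]; ring
    have hint := intervalIntegral.norm_integral_le_of_norm_le_const hbound
    rw [sub_zero, abs_one, mul_one] at hint
    have hfact : ((n ! : ℕ) : ℝ)⁻¹ ≤ 1 := by
      rw [inv_le_one_iff₀]
      exact Or.inr (by exact_mod_cast Nat.one_le_iff_ne_zero.2 (Nat.factorial_ne_zero n))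
    calc ((n ! : ℕ) : ℝ)⁻¹ * ‖∫ t in (0 : ℝ)..1, (1 - t) ^ n • (D (x + t • y) - D x) (fun _ => y)‖
        ≤ 1 * (C * ‖y‖ ^ (n + 1) * ‖y‖ ^ (r : ℝ)) := by
          gcongr
    _ = C * ‖y‖ ^ (n + 1) * ‖y‖ ^ (r : ℝ) := one_mul _

end Taylor

/-! ## The blocks of a `C^{k,r}_b` function: `‖Δ̇_j f‖_∞ ≲ 2^{-j(k+r)}` -/

section BlockEstimate

variable {E : Type*} [NormedAddCommGroup E] [InnerProductSpace ℝ E] [FiniteDimensional ℝ E]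
  [MeasurableSpace E] [BorelSpace E]

/-- `a^k a^r = a^{k+r}` for `a ≥ 0`, `r ≥ 0` (natural `k`, real `r`; no exception at `a = 0`). [folklore] -/
theorem pow_mul_rpow_eq_rpow_add {a : ℝ} (ha : 0 ≤ a) (k : ℕ) {r : ℝ} (hr : 0 ≤ r) :
    a ^ k * a ^ r = a ^ ((k : ℝ) + r) := by
  rw [Real.rpow_add_of_nonneg ha k.cast_nonneg hr, Real.rpow_natCast]

/-- The weighted `L¹` norms `∫ |K_j(t)| ‖t‖^s dt` of the Littlewood–Paley kernels are finite for
`s ≥ 0` (Schwartz decay). [folklore] -/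
theorem integrable_norm_blockKernel_mul_norm_rpow (j : ℤ) {s : ℝ} (hs : 0 ≤ s) :
    Integrable (fun t : E => ‖blockKernel E j t‖ * ‖t‖ ^ s) (volume : Measure E) := by
  set n : ℕ := ⌈s⌉₊ with hn
  have hsn : s ≤ n := Nat.le_ceil s
  have hpt : ∀ t : E, ‖t‖ ^ s ≤ 1 + ‖t‖ ^ n := by
    intro t
    rcases le_or_gt ‖t‖ 1 with ht | ht
    · calc ‖t‖ ^ s ≤ 1 := Real.rpow_le_one (norm_nonneg _) ht hs
        _ ≤ 1 + ‖t‖ ^ n := le_add_of_nonneg_right (by positivity)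
    · calc ‖t‖ ^ s ≤ ‖t‖ ^ (n : ℝ) := Real.rpow_le_rpow_of_exponent_le ht.le hsn
        _ = ‖t‖ ^ n := Real.rpow_natCast _ _
        _ ≤ 1 + ‖t‖ ^ n := le_add_of_nonneg_left zero_le_one
  have hK := (blockKernelC E j).integrable (μ := (volume : Measure E))
  have hKn := (blockKernelC E j).integrable_pow_mul (volume : Measure E) n
  refine Integrable.mono' (hK.norm.add hKn)
    ((continuous_blockKernel j).norm.mul (continuous_norm.rpow_const fun _ => Or.inr hs)).aestronglyMeasurable
    (Eventually.of_forall fun t => ?_)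
  rw [Real.norm_of_nonneg (by positivity), norm_blockKernel]
  calc ‖blockKernelC E j t‖ * ‖t‖ ^ s ≤ ‖blockKernelC E j t‖ * (1 + ‖t‖ ^ n) := by
        gcongr
        exact hpt t
    _ = ‖(blockKernelC E j : E → ℂ) t‖ + ‖t‖ ^ n * ‖(blockKernelC E j : E → ℂ) t‖ := by ring

/-- **Dyadic scaling of the weighted `L¹` norms**:
`∫ |K_j(t)| ‖t‖^s dt = 2^{-js} ∫ |K₀(z)| ‖z‖^s dz` (`K_j = 2^{jd} K₀(2^j ·)` and the substitution
`z = 2^j t`). [folklore] -/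
theorem integral_norm_blockKernel_mul_norm_rpow (j : ℤ) (s : ℝ) :
    ∫ t, ‖blockKernel E j t‖ * ‖t‖ ^ s =
      (2 : ℝ) ^ (-(j : ℝ) * s) * ∫ z, ‖blockKernel E 0 z‖ * ‖z‖ ^ s := by
  set d : ℕ := Module.finrank ℝ E with hd
  set c : ℝ := (2 : ℝ) ^ j with hc
  have hc0 : 0 < c := zpow_pos two_pos _
  -- `‖K_j t‖ ‖t‖^s = 2^{jd} G(c • t)` with `G z = ‖K₀ z‖ (c⁻¹ ‖z‖)^s`
  set G : E → ℝ := fun z => ‖blockKernel E 0 z‖ * (c⁻¹ * ‖z‖) ^ s with hG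
  have hpt : ∀ t : E, ‖blockKernel E j t‖ * ‖t‖ ^ s = (2 : ℝ) ^ (j * (d : ℤ)) * G (c • t) := by
    intro t
    rw [blockKernel_eq_scale j t, norm_mul, Real.norm_of_nonneg (zpow_nonneg zero_le_two _), hG]
    simp only
    rw [norm_smul, Real.norm_of_nonneg hc0.le, ← mul_assoc c⁻¹, inv_mul_cancel₀ hc0.ne', one_mul,
      mul_assoc]
  have hGint : ∫ z, G z = c ^ (-s) * ∫ z, ‖blockKernel E 0 z‖ * ‖z‖ ^ s := by
    rw [← integral_const_mul]
    refine integral_congr_ae (Eventually.of_forall fun z => ?_)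
    simp only [hG]
    rw [Real.mul_rpow (inv_nonneg.2 hc0.le) (norm_nonneg _), Real.inv_rpow hc0.le, Real.rpow_neg hc0.le]
    ring
  simp_rw [hpt]
  rw [integral_const_mul, Measure.integral_comp_smul volume G c, hGint, smul_eq_mul]
  -- the constants: `2^{jd} |c^{-d}| c^{-s} = 2^{-js}`
  have h1 : (2 : ℝ) ^ (j * (d : ℤ)) * |(c ^ d)⁻¹| = 1 := by
    rw [abs_of_pos (inv_pos.2 (pow_pos hc0 d)), hc, ← zpow_natCast, ← zpow_mul, mul_inv_cancel₀]
    exact zpow_ne_zero _ two_ne_zero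
  have h2 : c ^ (-s) = (2 : ℝ) ^ (-(j : ℝ) * s) := by
    rw [hc, ← Real.rpow_intCast, ← Real.rpow_mul zero_le_two]
    ring_nf
  calc (2 : ℝ) ^ (j * (d : ℤ)) * (|(c ^ d)⁻¹| * (c ^ (-s) * ∫ z, ‖blockKernel E 0 z‖ * ‖z‖ ^ s))
      = ((2 : ℝ) ^ (j * (d : ℤ)) * |(c ^ d)⁻¹|) * c ^ (-s) * ∫ z, ‖blockKernel E 0 z‖ * ‖z‖ ^ s := by
        ring
    _ = (2 : ℝ) ^ (-(j : ℝ) * s) * ∫ z, ‖blockKernel E 0 z‖ * ‖z‖ ^ s := by rw [h1, one_mul, h2]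

variable {F : Type*} [NormedAddCommGroup F] [NormedSpace ℝ F] [CompleteSpace F]

/-- **The blocks annihilate Taylor polynomials**: for every `x` and every family of multilinear
maps `M_m` (`m ≤ k`), `∫ K_j(t) • ∑_{m ≤ k} c_m • M_m(-t, …, -t) dt = 0` — each term is a moment of
`K_j` (`integral_blockKernel_smul_multilinear_eq_zero` for `M_m ∘ (-id)`). [folklore] -/
theorem integral_blockKernel_smul_taylor_eq_zero (j : ℤ) {k : ℕ} (f : E → F) (x : E) :
    ∫ t, blockKernel E j t •
      ∑ m ∈ Finset.range (k + 1), (m ! : ℝ)⁻¹ • iteratedFDeriv ℝ m f x (fun _ => -t) = 0 := by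
  -- each term is `c_m • K_j(t) • (M_m ∘ (-id))(t, …, t)`
  set N : ∀ m : ℕ, E [×m]→L[ℝ] F := fun m =>
    (iteratedFDeriv ℝ m f x).compContinuousLinearMap fun _ => -ContinuousLinearMap.id ℝ E with hN
  have hNap : ∀ (m : ℕ) (t : E), N m (fun _ => t) = iteratedFDeriv ℝ m f x (fun _ => -t) := by
    intro m t
    simp [hN]
  have hterm : ∀ m ∈ Finset.range (k + 1), Integrable
      (fun t : E => blockKernel E j t • ((m ! : ℝ)⁻¹ • iteratedFDeriv ℝ m f x (fun _ => -t))) volume := by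
    intro m _
    have h := (integrable_blockKernel_smul_multilinear (F := F) j (N m)).smul (m ! : ℝ)⁻¹
    refine h.congr (Eventually.of_forall fun t => ?_)
    simp only [Pi.smul_apply, hNap]
    rw [smul_comm]
  simp_rw [Finset.smul_sum]
  rw [integral_finsetSum _ hterm]
  refine Finset.sum_eq_zero fun m _ => ?_
  simp_rw [smul_comm (blockKernel E j _) ((m ! : ℝ)⁻¹), ← hNap]
  rw [integral_smul, integral_blockKernel_smul_multilinear_eq_zero, smul_zero]

/-- **Pointwise bound of the blocks of a `C^{k,r}` function.** If `f : E → F` is `C^k`, bounded,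
with `r`-Hölder `k`-th derivative, `[D^k f]_r ≤ C` (`0 ≤ r`), then for every `j ∈ ℤ` and `x`,
`‖(K_j ⋆ f)(x)‖ ≤ C ∫ |K_j(t)| ‖t‖^{k+r} dt`: write `f(x - t) = P_x(-t) + R_x(-t)` with the Taylor
polynomial `P_x` of degree `k` at `x` (annihilated by `K_j`, `integral_blockKernel_smul_taylor_eq_zero`)
and the remainder `‖R_x(-t)‖ ≤ C ‖t‖^k ‖t‖^r` (`norm_sub_taylor_le_of_holderWith`)
(Grafakos, *Modern Fourier Analysis*, 3rd ed., proof of Thm. 1.4.6, (1.4.7)). [folklore] -/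
theorem norm_blockFn_le_of_holderWith {f : E → F} {k : ℕ} {r C : ℝ≥0} (hf : ContDiff ℝ k f)
    (hH : HolderWith C r (iteratedFDeriv ℝ k f)) {M₀ : ℝ} (hM₀ : ∀ z, ‖f z‖ ≤ M₀) (j : ℤ) (x : E) :
    ‖blockFn j f x‖ ≤ C * ∫ t, ‖blockKernel E j t‖ * ‖t‖ ^ ((k : ℝ) + r) := by
  set P : E → F := fun t => ∑ m ∈ Finset.range (k + 1), (m ! : ℝ)⁻¹ • iteratedFDeriv ℝ m f x (fun _ => -t)
    with hP
  have hfc : Continuous f := hf.continuous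
  -- integrability of the three integrands
  have hint_f : Integrable (fun t : E => blockKernel E j t • f (x - t)) volume :=
    integrable_blockKernel_smul_sub_of_bound j hfc.aestronglyMeasurable hM₀ x
  have hint_P : Integrable (fun t : E => blockKernel E j t • P t) volume := by
    have hterm : ∀ m ∈ Finset.range (k + 1), Integrable
        (fun t : E => blockKernel E j t • ((m ! : ℝ)⁻¹ • iteratedFDeriv ℝ m f x (fun _ => -t))) volume := by
      intro m _
      set N : E [×m]→L[ℝ] F :=
        (iteratedFDeriv ℝ m f x).compContinuousLinearMap fun _ => -ContinuousLinearMap.id ℝ E with hN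
      have h := (integrable_blockKernel_smul_multilinear (F := F) j N).smul (m ! : ℝ)⁻¹
      refine h.congr (Eventually.of_forall fun t => ?_)
      simp only [Pi.smul_apply, hN, ContinuousMultilinearMap.compContinuousLinearMap_apply,
        neg_apply, ContinuousLinearMap.coe_id', id_eq]
      rw [smul_comm]
    have h := integrable_finsetSum (Finset.range (k + 1)) hterm
    refine h.congr (Eventually.of_forall fun t => ?_)
    simp only [hP, Finset.smul_sum]
  -- `K_j ⋆ f (x) = ∫ K_j(t) • R(t) dt`, `R(t) = f(x - t) - P(t)`
  have hsplit : blockFn j f x = ∫ t, blockKernel E j t • (f (x - t) - P t) := by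
    rw [blockFn_apply]
    simp only [smul_sub]
    rw [integral_sub hint_f hint_P, hP, integral_blockKernel_smul_taylor_eq_zero, sub_zero]
  rw [hsplit]
  -- the remainder estimate
  have hR : ∀ t : E, ‖blockKernel E j t • (f (x - t) - P t)‖ ≤
      C * (‖blockKernel E j t‖ * ‖t‖ ^ ((k : ℝ) + r)) := by
    intro t
    have h := norm_sub_taylor_le_of_holderWith hf hH x (-t)
    rw [← sub_eq_add_neg, norm_neg] at h
    rw [norm_smul, ← pow_mul_rpow_eq_rpow_add (norm_nonneg _) k r.coe_nonneg]
    calc ‖blockKernel E j t‖ * ‖f (x - t) - P t‖ ≤ ‖blockKernel E j t‖ * (C * ‖t‖ ^ k * ‖t‖ ^ (r : ℝ)) :=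
          mul_le_mul_of_nonneg_left h (norm_nonneg _)
      _ = C * (‖blockKernel E j t‖ * (‖t‖ ^ k * ‖t‖ ^ (r : ℝ))) := by ring
  have hw := integrable_norm_blockKernel_mul_norm_rpow (E := E) j (s := (k : ℝ) + r) (by positivity)
  calc ‖∫ t, blockKernel E j t • (f (x - t) - P t)‖
      ≤ ∫ t, C * (‖blockKernel E j t‖ * ‖t‖ ^ ((k : ℝ) + r)) :=
        norm_integral_le_of_norm_le (hw.const_mul _) (Eventually.of_forall hR)
    _ = C * ∫ t, ‖blockKernel E j t‖ * ‖t‖ ^ ((k : ℝ) + r) := integral_const_mul _ _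

/-- **`‖Δ̇_j f‖_∞ ≤ C [D^k f]_r 2^{-j(k+r)} ∫ |K₀(z)| ‖z‖^{k+r} dz`** for `f ∈ C^k` bounded with
`r`-Hölder `D^k f` — the pointwise block estimate with the dyadic scaling of the weighted kernel
norms (`integral_norm_blockKernel_mul_norm_rpow`). [folklore] -/
theorem norm_blockFn_le_two_rpow_neg {f : E → F} {k : ℕ} {r C : ℝ≥0} (hf : ContDiff ℝ k f)
    (hH : HolderWith C r (iteratedFDeriv ℝ k f)) {M₀ : ℝ} (hM₀ : ∀ z, ‖f z‖ ≤ M₀) (j : ℤ) (x : E) :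
    ‖blockFn j f x‖ ≤ C * (2 : ℝ) ^ (-(j : ℝ) * ((k : ℝ) + r)) *
      ∫ z, ‖blockKernel E 0 z‖ * ‖z‖ ^ ((k : ℝ) + r) := by
  rw [mul_assoc, ← integral_norm_blockKernel_mul_norm_rpow]
  exact norm_blockFn_le_of_holderWith hf hH hM₀ j x

end BlockEstimate

/-! ## `C^{k,r}_b ⊂ B^{k+r}_{∞,∞}` -/

section Besov

variable {E : Type*} [NormedAddCommGroup E] [InnerProductSpace ℝ E] [FiniteDimensional ℝ E]
  [MeasurableSpace E] [BorelSpace E] {F : Type*} [NormedAddCommGroup F] [NormedSpace ℂ F]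
  [CompleteSpace F]

/-- **The blocks of an `L^∞` function are the functions `K_j ⋆ f`**: for `f ∈ L^∞(E; F)` bounded
by `B` after convolution, i.e. `‖(K_j ⋆ f)(x)‖ ≤ B` for all `x`, the block `Δ̇_j ↑f` of the
distribution of `f` is the distribution of the bounded function `K_j ⋆ f`, so
`‖Δ̇_j ↑f‖_{L^∞} ≤ B` (`Δ̇_j = φ_j(D)` acts on `L^p` by convolution with `𝓕⁻¹φ_j = K_j`,
`Literature.Analysis.FunctionSpaces.fourierMultiplierCLM_coe_apply_eq_integral_convolution`). [folklore] -/
theorem eLpNormDistrib_lpBlock_coe_le_of_bound {f : E → F} (hf : MemLp f ∞ (volume : Measure E))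
    (j : ℤ) {B : ℝ} (hB : ∀ x, ‖blockFn j f x‖ ≤ B) :
    eLpNormDistrib ∞ (lpBlock j ((hf.toLp f : Lp F ∞ (volume : Measure E)) : 𝓢'(E, F))) ≤
      ENNReal.ofReal B := by
  set g : Lp F ∞ (volume : Measure E) := hf.toLp f with hg
  have hfg : blockFn j (g : E → F) = blockFn j f := blockFn_congr_ae j hf.coeFn_toLp
  have hmeas : AEStronglyMeasurable (blockFn j f) volume := aestronglyMeasurable_blockFn j hf.1
  have hmem : MemLp (blockFn j f) ∞ (volume : Measure E) :=
    memLp_top_of_bound hmeas B (Eventually.of_forall hB)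
  -- `Δ̇_j ↑g = ↑(K_j ⋆ f)`
  have hrep : ((hmem.toLp _ : Lp F ∞ (volume : Measure E)) : 𝓢'(E, F)) = lpBlock j (g : 𝓢'(E, F)) := by
    rw [lpBlock_apply, ← coe_dyadicSymbolSchwartz]
    ext u
    rw [Lp.toTemperedDistribution_apply, fourierMultiplierCLM_coe_apply_eq_integral_convolution,
      show (𝓕⁻ (dyadicSymbolSchwartz E j) : 𝓢(E, ℂ)) = blockKernelC E j from rfl,
      blockKernelC_convolution_eq_blockFn, hfg]
    refine integral_congr_ae ?_
    filter_upwards [hmem.coeFn_toLp] with y hy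
    rw [hy]
  calc eLpNormDistrib ∞ (lpBlock j (g : 𝓢'(E, F)))
      ≤ ‖(hmem.toLp _ : Lp F ∞ (volume : Measure E))‖ₑ := by rw [← hrep]; exact eLpNormDistrib_coe_le _
    _ = eLpNorm (blockFn j f) ∞ volume := Lp.enorm_toLp hmem
    _ ≤ ENNReal.ofReal B := by
        rw [eLpNorm_exponent_top]
        exact eLpNormEssSup_le_of_ae_bound (Eventually.of_forall hB)

/-- `2^{js} · 2^{-js} B = B` in `ℝ≥0∞`, the bookkeeping of the Besov weights. [folklore] -/
theorem two_rpow_mul_ofReal_two_rpow_neg_mul (j s B : ℝ) :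
    (2 : ℝ≥0∞) ^ (j * s) * ENNReal.ofReal ((2 : ℝ) ^ (-j * s) * B) = ENNReal.ofReal B := by
  rw [ENNReal.ofReal_mul (Real.rpow_nonneg zero_le_two _), ← mul_assoc,
    ← ENNReal.ofReal_ofNat 2, ENNReal.ofReal_rpow_of_pos two_pos, ← ENNReal.ofReal_mul
      (Real.rpow_nonneg zero_le_two _), ← Real.rpow_add two_pos, show j * s + -j * s = 0 by ring,
    Real.rpow_zero, ENNReal.ofReal_one, one_mul]

/-- **`C^{k,r}_b ⊂ B^{k+r}_{∞,∞}`** (Triebel 1983, Thm. 2.5.7 with (2.5.7/9), one inclusion;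
Grafakos, *Modern Fourier Analysis*, Thm. 1.4.9, (1.4.23)): if `f : E → F` lies in `C^{k,r}_b`
(`Literature.Analysis.FunctionSpaces.MemContDiffHolder k r f`: `C^k`, all derivatives of order
`≤ k` bounded, `D^k f` `r`-Hölder) then its distribution `↑f ∈ 𝓢'(E, F)` has finite inhomogeneous
Besov norm `‖↑f‖_{B^{k+r}_{∞,∞}} = ‖Ṡ₀ f‖_{L^∞} + sup_{j ≥ 1} 2^{j(k+r)} ‖Δ̇_j f‖_{L^∞} < ∞`:
`Ṡ₀ f ∈ L^∞` by Young's inequality, and `‖Δ̇_j f‖_{L^∞} ≤ C [D^k f]_r 2^{-j(k+r)}`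
(`norm_blockFn_le_two_rpow_neg`). No restriction on `r ≥ 0` is needed for this inclusion. [cite: Triebel1983, Thm. 2.5.7] -/
theorem memBesov_top_top_coe_of_memContDiffHolder {k : ℕ} {r : ℝ≥0} {f : E → F}
    (hf : MemContDiffHolder k r f) (hLp : MemLp f ∞ (volume : Measure E)) :
    MemBesov ((k : ℝ) + r) ∞ ∞ ((hLp.toLp f : Lp F ∞ (volume : Measure E)) : 𝓢'(E, F)) := by
  obtain ⟨C, hC⟩ := hf.memHolder_iteratedFDeriv
  obtain ⟨M₀, hM₀⟩ : ∃ M₀ : ℝ, ∀ z, ‖f z‖ ≤ M₀ := by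
    obtain ⟨M, hM⟩ := eSupNorm_lt_top_iff.1 (hf.2.1 0 (Nat.zero_le k))
    exact ⟨M, fun z => by simpa [norm_iteratedFDeriv_zero] using hM z⟩
  set s : ℝ := (k : ℝ) + r with hs
  set I₀ : ℝ := ∫ z, ‖blockKernel E 0 z‖ * ‖z‖ ^ s with hI₀
  have hI₀0 : 0 ≤ I₀ := integral_nonneg fun z => by positivity
  set u : 𝓢'(E, F) := ((hLp.toLp f : Lp F ∞ (volume : Measure E)) : 𝓢'(E, F)) with hu
  -- the blocks
  have hblock : ∀ j : ℤ, eLpNormDistrib ∞ (lpBlock j u) ≤ ENNReal.ofReal (C * (2 : ℝ) ^ (-(j : ℝ) * s) * I₀) :=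
    fun j => eLpNormDistrib_lpBlock_coe_le_of_bound hLp j
      (fun x => norm_blockFn_le_two_rpow_neg hf.contDiff hC hM₀ j x)
  refine ENNReal.add_lt_top.2 ⟨eLpNormDistrib_lowFreqCutoff_coe_lt_top 0 _, ?_⟩
  rw [eLpNorm_exponent_top, eLpNormEssSup_count]
  refine lt_of_le_of_lt (iSup_le fun n => ?_) (ENNReal.ofReal_lt_top (r := C * I₀))
  rw [enorm_eq_self, lpBlockWeightSucc, lpBlockWeight]
  calc (2 : ℝ≥0∞) ^ ((((n : ℤ) + 1 : ℤ) : ℝ) * s) * eLpNormDistrib ∞ (lpBlock ((n : ℤ) + 1) u)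
      ≤ (2 : ℝ≥0∞) ^ ((((n : ℤ) + 1 : ℤ) : ℝ) * s) *
          ENNReal.ofReal (C * (2 : ℝ) ^ (-(((n : ℤ) + 1 : ℤ) : ℝ) * s) * I₀) := by
        gcongr
        exact hblock _
    _ = ENNReal.ofReal (C * I₀) := by
        rw [show (C : ℝ) * (2 : ℝ) ^ (-(((n : ℤ) + 1 : ℤ) : ℝ) * s) * I₀ =
            (2 : ℝ) ^ (-(((n : ℤ) + 1 : ℤ) : ℝ) * s) * (C * I₀) by ring,
          two_rpow_mul_ofReal_two_rpow_neg_mul]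

end Besov

end Literature.Analysis.FunctionSpaces
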